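import Literature.Analysis.FluidPDE.OnsagerBDSVBiotSavart
import Literature.Analysis.FluidPDE.StatisticalSolution
import Literature.Analysis.FunctionSpaces.TorusFluidGlueProofs
import Literature.Analysis.FunctionSpaces.TorusCalculusProofs

/-!
# Helicity conservation of the inertial term on `T³`

Helper file for stub S6 (`stub_order2Design`) and S5 (`stub_order3Surgery`) of the line
`recession-cone` of crux `MomentParity.QuarticGate`: for a smooth divergence-free field `w` on
the unit three-torus, the transport nonlinearity does no work against the vorticity,
`∫ ⟪(w·∇)w, curl w⟫ = 0` (pointwise `(w·∇)w = (curl w) × w + ∇|w|²/2`, `⟪(curl w) × w, curl w⟫ = 0`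
and `div curl w = 0`). Consequently the inertial pairing `∫ (u ⊗ u) : ∇(curl w)` of an `L²` class
`u` represented by `w` vanishes — the HELICITY ROW of the Galerkin generator has no cubic term.
-/

namespace Summit.AnomalousDissipation.AnomalousDissipation.Theorems.MomentParityQuarticGate

open MeasureTheory Filter
open scoped InnerProductSpace RealInnerProductSpace
open Literature.Analysis.FunctionSpaces Literature.Analysis.FluidPDE

set_option linter.dupNamespace false

/-- **Pointwise Lamb identity against the vorticity**: for a `C¹` field `w` on `T³`,
`⟪(w·∇)w, curl w⟫ = ½ D(|w|²)[curl w]` at every point (the antisymmetric part of `Dw` acts on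
`w` as `(curl w) × w ⊥ curl w`). [folklore] -/
theorem inner_convect_self_curl_eq {w : UnitAddTorus (Fin 3) → EuclideanSpace ℝ (Fin 3)}
    (hw : Torus.IsContDiff 1 w) (x : UnitAddTorus (Fin 3)) :
    ⟪Torus.convect w w x, BDSV.curl w x⟫_ℝ =
      2⁻¹ * Torus.fderiv (fun y => ‖w y‖ ^ 2) x (BDSV.curl w x) := by
  rw [Torus.fderiv_norm_sq_apply hw, Torus.convect, Torus.fderiv_apply_eq_sum_partialDeriv hw,
    Torus.fderiv_apply_eq_sum_partialDeriv hw]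
  have h0 := BDSV.curl_apply_zero w x
  have h1 := BDSV.curl_apply_one w x
  have h2 := BDSV.curl_apply_two w x
  set c := BDSV.curl w x with hc
  simp only [PiLp.inner_apply, RCLike.inner_apply, conj_trivial, Fin.sum_univ_three, PiLp.add_apply,
    PiLp.smul_apply, smul_eq_mul]
  rw [h0, h1, h2]
  ring

/-- **Helicity conservation of the transport term**: `∫_{T³} ⟪(w·∇)w, curl w⟫ = 0` for every
smooth divergence-free `w` (the integrand is `½ D(|w|²)[curl w]` and `curl w` is smooth and
divergence free, so the transport identity `∫ Dθ[v] = 0` applies). [folklore] -/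
theorem integral_inner_convect_self_curl_eq_zero
    {w : UnitAddTorus (Fin 3) → EuclideanSpace ℝ (Fin 3)} (hw : Torus.IsSmooth w) :
    ∫ x, ⟪Torus.convect w w x, BDSV.curl w x⟫_ℝ = 0 := by
  simp_rw [inner_convect_self_curl_eq (hw.isContDiff (by simp)), integral_const_mul]
  rw [Torus.integral_fderiv_apply_eq_zero_of_isDivFree (BDSV.isSmooth_curl hw) hw.norm_sq
    (BDSV.divergence_curl hw), mul_zero]

/-- The same with the factors of the inner product exchanged. [folklore] -/
theorem integral_inner_curl_convect_self_eq_zero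
    {w : UnitAddTorus (Fin 3) → EuclideanSpace ℝ (Fin 3)} (hw : Torus.IsSmooth w) :
    ∫ x, ⟪BDSV.curl w x, Torus.convect w w x⟫_ℝ = 0 := by
  rw [← integral_inner_convect_self_curl_eq_zero hw]
  exact integral_congr_ae (ae_of_all _ fun x => real_inner_comm _ _)

/-- **The inertial pairing against the vorticity vanishes (helicity row, cubic term)**: if the
`L²` class `u` is represented by a smooth divergence-free field `w` (`u = w` a.e.), then
`Torus.inertialPairing u (curl w) = ∫ (u ⊗ u) : ∇(curl w) = 0` (`= ∫ ⟪(w·∇)(curl w), w⟫ =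
-∫ ⟪curl w, (w·∇)w⟫ = 0` by antisymmetry of the trilinear form and helicity conservation).
Registered sub-goal `helicity_inertialPairing_curl` of stub S6 (`stub_order2Design`), also used
by S5. [folklore] -/
theorem helicity_inertialPairing_curl : ∀ (w : UnitAddTorus (Fin 3) → EuclideanSpace ℝ (Fin 3)) (u : Lp (EuclideanSpace ℝ (Fin 3)) 2 (volume : Measure (UnitAddTorus (Fin 3)))), Torus.IsSmooth w → Torus.IsDivFree w → (u : UnitAddTorus (Fin 3) → EuclideanSpace ℝ (Fin 3)) =ᵐ[volume] w → Torus.inertialPairing u (BDSV.curl w) = 0 := by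
  intro w u hw hdiv hu
  unfold Torus.inertialPairing
  rw [integral_congr_ae (g := fun x => ⟪Torus.convect w (BDSV.curl w) x, w x⟫_ℝ)
    (hu.mono fun x hx => by simp only [hx, Torus.convect])]
  rw [Torus.integral_inner_convect_eq_neg hw hdiv (BDSV.isSmooth_curl hw) hw,
    integral_inner_curl_convect_self_eq_zero hw, neg_zero]

/-- **Helicity row, cubic term, for an element of the energy space**: if `U ∈ H` is represented
by a smooth divergence-free `w`, then `Torus.inertialPairing U.1 (curl w) = 0`. [folklore] -/
theorem inertialPairing_coe_curl_eq_zero (U : Torus.energySpace (Fin 3))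
    {w : UnitAddTorus (Fin 3) → EuclideanSpace ℝ (Fin 3)} (hw : Torus.IsSmooth w)
    (hdiv : Torus.IsDivFree w)
    (hU : ((U.1 : Lp (EuclideanSpace ℝ (Fin 3)) 2 (volume : Measure (UnitAddTorus (Fin 3)))) :
      UnitAddTorus (Fin 3) → EuclideanSpace ℝ (Fin 3)) =ᵐ[volume] w) :
    Torus.inertialPairing (U.1 : Lp (EuclideanSpace ℝ (Fin 3)) 2 (volume : Measure (UnitAddTorus (Fin 3))))
      (BDSV.curl w) = 0 :=
  helicity_inertialPairing_curl w _ hw hdiv hU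

end Summit.AnomalousDissipation.AnomalousDissipation.Theorems.MomentParityQuarticGate
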